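import Summits.BirchSwinnertonDyer.Rank1Residual.X1.MuLambdaAlgebra
import Summits.BirchSwinnertonDyer.Rank1Residual.Supersingular.SignedLambdaParityTwoMazurTate
import Literature.RingTheory.Binomial.ChooseDivNatCast
import Mathlib.NumberTheory.Padics.RingHoms
import Mathlib.Algebra.CharP.Lemmas
import Mathlib.Algebra.CharP.Algebra
import HarnessLib

/-!
# `(1+T)^f mod (2, T^{2ⁿ})` depends only on `f mod 2ⁿ` (Euler side of the BC5 rung)

Cell `bsd-rank2` (D-0036), seat `bsd-rank2-eng` GEN 9 (director-bsd g9 ruling (R3): BC5 rung «(★_S) mod T⁸ on 15A8», Stage D,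
Euler/binomial side). The Eisenstein-side factors of (★-core) are `red((1+T)^{f_ℓ} − 1)` and `red((1+T)^e)` for `2`-adic
exponents `f_ℓ, e ∈ ℤ₂` (`PowerSeries.binomialSeries`). To evaluate them modulo `T⁸` one only needs the exponents modulo `8`:

* **`coeff_red_binomialSeries_eq_of_eq_add_nsmul`**: if `f = f₀ + 2ⁿ·g` in `ℤ₂` (`f₀ : ℕ`, `g : ℤ₂`), then for all `k < 2ⁿ`,
  `[T^k] red((1+T)^f) = [T^k] red((1+T)^{f₀})` — because `(1+T)^{2ⁿ g} = ((1+T)^g)^{2ⁿ} ≡ 1 (mod 2, T^{2ⁿ})` (Frobenius in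
  characteristic `2`: `(1 + Tψ)^{2ⁿ} = 1 + T^{2ⁿ}ψ^{2ⁿ}`).

(`red = PowerSeries.map (IsLocalRing.residue ℤ_[2])`, the line's reduction `MuLambda.red`.) THEOREMS ONLY; no `sorry`.
PARTITION: none — r_an ≥ 2, summit axis S0; TWIN (D-0056): n/a. B1 honesty: pure algebra; nothing reads an analytic rank.

References: L. C. Washington, *Introduction to cyclotomic fields* (1997), §7.1–§7.2 [Washington1997];
R. Greenberg, V. Vatsal, *Invent. Math.* 142 (2000), §1 p. 9 (`γ_ℓ = (1+T)^{f_ℓ}`) [GreenbergVatsal2000].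
-/

noncomputable section

open Literature.NumberTheory.EllipticCurves
open Summit.BirchSwinnertonDyer.Rank1Residual.X1

namespace Summit.BirchSwinnertonDyer.Rank2.LevelFifteen

/-- In characteristic `2`: a power series with constant term `1`, raised to the power `2ⁿ`, is `≡ 1 (mod T^{2ⁿ})`.
[folklore] -/
theorem coeff_mul_pow_two_pow_eq {F : Type*} [Field F] [CharP F 2] (A φ : PowerSeries F)
    (hφ : PowerSeries.constantCoeff φ = 1) (n k : ℕ) (hk : k < 2 ^ n) :
    PowerSeries.coeff k (A * φ ^ 2 ^ n) = PowerSeries.coeff k A := by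
  haveI : Fact (Nat.Prime 2) := ⟨Nat.prime_two⟩
  haveI : CharP (PowerSeries F) 2 := charP_of_injective_ringHom (f := PowerSeries.C) (PowerSeries.C_injective) 2
  set ψ : PowerSeries F := PowerSeries.mk fun p ↦ PowerSeries.coeff (p + 1) φ with hψ
  have hdec : φ = PowerSeries.X * ψ + 1 := by
    have h := PowerSeries.eq_X_mul_shift_add_const φ
    rw [hφ, map_one] at h
    exact h
  rw [hdec, add_pow_char_pow (R := PowerSeries F) (p := 2), one_pow, mul_add, mul_one, map_add, mul_pow,
    ← mul_assoc, mul_comm A, mul_assoc, PowerSeries.coeff_X_pow_mul', if_neg (not_le.mpr hk), zero_add]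

/-- **`(1+T)^f mod (2, T^{2ⁿ})` depends only on `f mod 2ⁿ`**: if `f = f₀ + 2ⁿ•g` in `ℤ₂` then the first `2ⁿ` coefficients of
`red((1+T)^f)` and `red((1+T)^{f₀})` agree. [cite: Washington1997, §7.2] -/
theorem coeff_red_binomialSeries_eq_of_eq_add_nsmul {f g : ℤ_[2]} {f₀ n : ℕ} (hf : f = (f₀ : ℤ_[2]) + 2 ^ n • g)
    (k : ℕ) (hk : k < 2 ^ n) :
    PowerSeries.coeff k (MuLambda.red (PowerSeries.binomialSeries ℤ_[2] f)) =
      PowerSeries.coeff k (MuLambda.red (((1 : IwasawaAlgebra 2) + PowerSeries.X) ^ f₀)) := by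
  haveI : CharP (IsLocalRing.ResidueField ℤ_[2]) 2 := Rank1Residual.Supersingular.charP_residueField_two
  rw [hf, PowerSeries.binomialSeries_add, PowerSeries.binomialSeries_nat,
    Literature.RingTheory.Binomial.binomialSeries_nsmul]
  simp only [MuLambda.red, map_mul, map_pow]
  refine coeff_mul_pow_two_pow_eq (F := IsLocalRing.ResidueField ℤ_[2]) _ _ ?_ n k hk
  rw [← PowerSeries.coeff_zero_eq_constantCoeff_apply, PowerSeries.coeff_map, PowerSeries.binomialSeries_coeff,
    Ring.choose_zero_right, one_smul, map_one]

/-- The same for the Eisenstein factor `(1+T)^f − 1`. [cite: Washington1997, §7.2] -/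
theorem coeff_red_binomialSeries_sub_one_eq_of_eq_add_nsmul {f g : ℤ_[2]} {f₀ n : ℕ}
    (hf : f = (f₀ : ℤ_[2]) + 2 ^ n • g) (k : ℕ) (hk : k < 2 ^ n) :
    PowerSeries.coeff k (MuLambda.red (PowerSeries.binomialSeries ℤ_[2] f - 1)) =
      PowerSeries.coeff k (MuLambda.red (((1 : IwasawaAlgebra 2) + PowerSeries.X) ^ f₀ - 1)) := by
  have h := coeff_red_binomialSeries_eq_of_eq_add_nsmul hf k hk
  simp only [MuLambda.red, map_sub, map_one] at h ⊢
  rw [h]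

end Summit.BirchSwinnertonDyer.Rank2.LevelFifteen

end
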